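import Summits.BirchSwinnertonDyer.Rank1Residual.ManinAdditive.OddDegreeTooth
import Literature.NumberTheory.EllipticCurves.Isogeny
import Literature.NumberTheory.EllipticCurves.QuadraticTwist
import HarnessLib
import HarnessLib.Audit.Tags

/-!
# WILD-OM `RbTotallyBlindWildOrbitMinimal` — C2's WILD totally-Kummer-blind residual restricted to the ORBIT-MINIMAL
# classes, BY NAME (cell `bsd-f2-manin`; lead `bsd-line-manin23-p1` gen 5, typing ask T-p1-g5-2, 2026-08-28T12:22:04Z)

HONEST FRAMING.  LENS = analytic / period-lattice (planner `bsd-f2-manin-an`, g17: the tame/wild split of the blind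
residual, `OddDegreeTooth.RbTotallyBlindTame` / `RbTotallyBlindWild`) as SHARPENED by the C2 lead `bsd-line-manin23-p1`
(gen 5, skeleton v12 of `kato_shift_two`, HOME/p1/Line-kato-shift-two-v12.lean 9e8a82ab335972fa, stub 6e): the wild
blind stub now carries the five twist-orbit-minimality clauses of p617384 (v10's blind stub VERBATIM with `2³ ∣ N` in
place of `2² ∣ N`), and the lead PROVED `RbTotallyBlindWild ⟹ WILD-OM`
(`Summit.BirchSwinnertonDyer.BirchSwinnertonDyer.Theorems.ManinLocalTwoThree.wildOrbitMinimal_of_rbTotallyBlindWild`,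
`Theorems/ManinLocalTwoThreeWildBlindOrbitMinimal.lean`, p632784 — under `Theorems/` because the `u = 1` model-change
plumbing `exists_datum_smul_blindData` lives in the route cone), so v12's open content SHRINKS relative to v11.  This
sibling of `OddDegreeTooth.lean` (kept apart to hold that file under 400 lines; same namespace) NAMES the stub's
signature VERBATIM so that v13 := all six stubs BY NAME (`stub_rbTotallyBlindWildOrbitMinimal : RbTotallyBlindWildOrbitMinimal`).

* **WILD-OM `RbTotallyBlindWildOrbitMinimal`** — for an `X₀(N)`-optimal `W` (lattice clause) with `2³ ∣ N` that is
  twist-orbit-minimal (no `−1, ±2`-twist partner of lower `2`-level; no `q*`-twist partner of lower `q`-level; the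
  three `2`-adic / `q*` descent exclusions of p617384) and admits a `u = 1` integral model `M` with `a₁ = a₃ = 0`,
  globally minimal, with a rational `2`-torsion root and EVERY rational root Kummer-blind (`KummerBlindAtTwo`), the
  Manin constant is odd.  In Cremona's range (`N < 5·10⁵`) the instances are 32a1, 128b1, 128d1 (the 31 `χ₋₁`-twists
  at `16(m² + 4)` of an's wild list leave by the orbit clauses); conjecturally nothing else (imc E-imc-29).  OPEN; an
  instance of Manin's `c₀` odd; no mechanism claimed.
No edges here: the two edges the line uses (`wildOrbitMinimal_of_rbTotallyBlindWild`,
`blindOrbitMinimalResidual_of_rbTotallyBlindTame_of_wildOrbitMinimal`) are the lead's, under `Theorems/` (p632784), and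
get re-pointed to this name by the lead.

REFUTER STATUS at filing: refuter-1 by-name probes of p632442 / p632784 asked by the lead (12:22:04Z), PENDING; the parent
rows `RbTotallyBlind` / `RbTotallyBlindTame` / `RbTotallyBlindWild` SURVIVE refuter-1 §R57 / RB63.  Filed on the lead's
explicit ask (precedents T-imc-8b, T-an-26, T-p1-g5-1).  Beyond-print theorem: no.  BSD is not proved by this; Manin's
conjecture is not proved by this.
-/

set_option autoImplicit false

noncomputable section

open PowerSeries CongruenceSubgroup
open WeierstrassCurve Literature.NumberTheory.EllipticCurves Literature.NumberTheory.EllipticCurves.ModularForms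

namespace Summit.BirchSwinnertonDyer.Rank1Residual.ManinAdditive.OddDegreeTooth

open Summit.BirchSwinnertonDyer.Rank1Residual.ManinAdditive.ShimuraLedger
  Summit.BirchSwinnertonDyer.Rank1Residual.ManinAdditive.CuspidalKummer

/-- **WILD-OM `RbTotallyBlindWildOrbitMinimal` (cell bsd-f2-manin / lead bsd-line-manin23-p1 gen 5; honest residual,
nothing asserted): the ORBIT-MINIMAL totally Kummer-blind WILD residual of C2** — `X₀(N)`-optimal `W` (lattice
clause), `2³ ∣ N`, the five twist-orbit-minimality clauses of p617384 VERBATIM (as in v10's blind stub and in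
`CuspidalKummerThree.NoRationalThreeTorsionOrbitMinimalResidual`), a `u = 1` integral model `M` of `W` with
`a₁ = a₃ = 0`, globally minimal, SOME rational `2`-torsion root and ALL rational roots Kummer-blind
(`KummerBlindAtTwo M.a₂ M.a₄ e`) ⟹ `2 ∤ c`.  VERBATIM the signature of `stub_rbTotallyBlindWildOrbitMinimal` of the
C2 skeleton v12 (HOME/p1/Line-kato-shift-two-v12.lean 9e8a82ab335972fa :98–130) = the hypothesis of the lead's
`wildOrbitMinimal_of_rbTotallyBlindWild` (p632784), which PROVES `RbTotallyBlindWild ⟹` this (so it is WEAKER than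
an's `RbTotallyBlindWild`).  Census (BC5 witness; an g17 MEMO-an §59, lead 12:22:04Z): in Cremona's range
`N < 5·10⁵` the wild totally blind optimal classes are the 31 `χ₋₁`-twists at `16(m² + 4)` (not orbit-minimal: clause 3)
and 32a1, 128b1, 128d1 — the instances of this residual, all with `c₀ = 1`; conjecturally no further instance (imc
E-imc-29).  Why it might fail: an orbit-minimal optimal curve at `8 ∣ N` with all rational `2`-torsion Kummer-blind
and EVEN Manin constant (none known; Cremona: `c₀ = 1` for all optimal curves `N < 5·10⁵`).  REF1 by-name probe
PENDING at filing (lead's ask).  Beyond-print theorem: no.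
[cite: Cremona2022ManinConstants, Table (shape only: `c₀ = 1` on the wild blind optimal classes `N < 5·10⁵`; the orbit-minimal wild blind residual is the cell's WILD-OM, C2 restricted, OPEN beyond — p632784)] -/
@[conjecture]
def RbTotallyBlindWildOrbitMinimal : Prop :=
  ∀ (W : WeierstrassCurve ℚ) [W.IsElliptic] [W.IsGloballyMinimal] {N : ℕ} [NeZero N]
    (D : ModularParametrizationData W N),
    (∀ z ∈ D.L.lattice, ∃ w ∈ periodLattice D.f, z = D.c * w) → 2 ^ 3 ∣ N →
    ¬ (∃ (W' : WeierstrassCurve ℚ) (d : ℤ), W'.IsElliptic ∧ W'.IsGloballyMinimal ∧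
      (d = -1 ∨ d = 2 ∨ d = -2) ∧ IsIsogenous W (W'.quadraticTwist (d : ℚ)) ∧
      ¬ 2 ^ 2 ∣ W'.conductorNorm ℤ) →
    ¬ (∃ (W' : WeierstrassCurve ℚ) (q : ℕ), W'.IsElliptic ∧ W'.IsGloballyMinimal ∧
      q.Prime ∧ q ≠ 2 ∧ q ^ 2 ∣ N ∧
      IsIsogenous W (W'.quadraticTwist (((-1 : ℤ) ^ (q / 2) * q : ℤ) : ℚ)) ∧
      ¬ q ^ 2 ∣ W'.conductorNorm ℤ) →
    ¬ (∃ (A : WeierstrassCurve ℚ), A.IsElliptic ∧ A.IsGloballyMinimal ∧ 2 ^ 4 ∣ N ∧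
      2 ^ 2 ∣ A.conductorNorm ℤ ∧ A.conductorNorm ℤ ∣ N ∧ A.conductorNorm ℤ < N ∧
      IsIsogenous W (A.quadraticTwist ((-1 : ℤ) : ℚ))) →
    ¬ (∃ (A : WeierstrassCurve ℚ) (_ : A.IsElliptic) (_ : A.IsGloballyMinimal) (N' : ℕ) (_ : NeZero N')
      (D' : ModularParametrizationData A N') (d : ℤ) (C : WeierstrassCurve ℚ) (u : VariableChange ℚ),
      C.IsElliptic ∧ C.IsGloballyMinimal ∧
      (∀ z ∈ D'.L.lattice, ∃ w ∈ periodLattice D'.f, z = D'.c * w) ∧ (d = 2 ∨ d = -2) ∧ 2 ^ 6 ∣ N ∧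
      2 ^ 2 ∣ A.conductorNorm ℤ ∧ A.conductorNorm ℤ ∣ N ∧
      IsIsogenous W (A.quadraticTwist (d : ℚ)) ∧ u • A.quadraticTwist (d : ℚ) = C ∧
      C.Δ = (d : ℚ) ^ 6 * A.Δ ∧
      (A.conductorNorm ℤ < N ∨ A.minimalDiscriminantInt.natAbs < W.minimalDiscriminantInt.natAbs)) →
    ¬ (∃ (A : WeierstrassCurve ℚ) (_ : A.IsElliptic) (_ : A.IsGloballyMinimal)
      (D' : ModularParametrizationData A N) (q : ℕ) (C : WeierstrassCurve ℚ) (u : VariableChange ℚ),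
      C.IsElliptic ∧ C.IsGloballyMinimal ∧
      (∀ z ∈ D'.L.lattice, ∃ w ∈ periodLattice D'.f, z = D'.c * w) ∧ q.Prime ∧ q ≠ 2 ∧ q ^ 2 ∣ N ∧
      IsIsogenous C W ∧ u • A.quadraticTwist (((-1 : ℤ) ^ (q / 2) * q : ℤ) : ℚ) = C ∧
      C.Δ = ((((-1 : ℤ) ^ (q / 2) * q : ℤ)) : ℚ) ^ 6 * A.Δ ∧
      A.minimalDiscriminantInt.natAbs < W.minimalDiscriminantInt.natAbs) →
    ∀ (C : VariableChange ℚ) (M : WeierstrassCurve ℤ), C.u = 1 → C • W = M.map (Int.castRingHom ℚ) →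
      M.a₁ = 0 → M.a₃ = 0 → (C • W).IsGloballyMinimal →
      (∃ e : ℤ, (C • W).twoTorsionPolynomial.toPoly.IsRoot (e : ℚ)) →
      (∀ e : ℤ, (C • W).twoTorsionPolynomial.toPoly.IsRoot (e : ℚ) → KummerBlindAtTwo M.a₂ M.a₄ e) →
      ¬ (2 : ℤ) ∣ D.c

end Summit.BirchSwinnertonDyer.Rank1Residual.ManinAdditive.OddDegreeTooth

end
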